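import Summits.AnomalousDissipation.AnomalousDissipation.Theorems.QuarticGate.Negative.LevelCeiling

/-!
# Negative knowledge for the crux `MomentParity.QuarticGate` (stmt-AnomalousDissipation-11464):
# the MOMENTUM ROW — an `ε`-independent energy floor from the single linear test `g = f`

Certified copy of section J of the cdisprove work file `Cruxes/QuarticGate/Disproof.lean`
(refuter-cdisprove-stmt-AnomalousDissipation-11464-g2-0, cycle 2). Supports stmt-AnomalousDissipation-11464;
no positive route-item statement is asserted.

Complement to the force floor of `EnergyRow.lean` (`ε ≤ ‖f‖₂√E`, quadratic energy test): the LINEAR test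
`g = f` (admissible whenever the force is band-limited at the level, as every trigonometric-polynomial force is)
has row `‖f‖₂² + ν(u, Δf) + ∫(u⊗u):∇f`, so every law whose linear rows vanish obeys
`‖f‖₂² ≤ ν‖Δf‖₂√E + C_f E` with `C_f = sup_x Σᵢ‖∂ᵢf(x)‖`: stationary ensembles under an `O(1)` force carry
`O(1)` energy whatever their dissipation (`E ≥ (‖f‖₂² − ν‖Δf‖₂√E)/C_f`), and with the force floor
`ε ≤ ((ν‖Δf‖₂√E + C_f E)·E)^{1/2} ≈ √C_f · E` — a large-scale turnover ceiling on top of the injection ceiling.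

* `force_sq_le_of_momentumRow` — the implication from the vanishing of the single row `∫⟨F(u), f⟩dμ = 0`.
* `force_sq_le_of_polyStationary`, `IsQuarticWitness.force_sq_le` — packaged for polynomially stationary
  level-`N` laws / `QuarticGate` witnesses whose force is a level-`N` band test.
-/

namespace Summit.AnomalousDissipation.AnomalousDissipation.Theorems.QuarticGate.Negative

open MeasureTheory Filter Topology
open scoped ENNReal InnerProductSpace RealInnerProductSpace
open Literature.Analysis.FunctionSpaces Literature.Analysis.FluidPDE
open Summit.AnomalousDissipation.AnomalousDissipation.Theses.MomentParity

set_option linter.dupNamespace false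

noncomputable section

/-! ## J. The momentum row: an energy floor from the single linear test `g = f` -/

section MomentumRow

/-- Local notation for the real Hilbert space `L²(T³; ℝ³)`. -/
local notation "L2T3" => Lp (EuclideanSpace ℝ (Fin 3)) 2 (volume : Measure (UnitAddTorus (Fin 3)))

/-- **The momentum row bounds the energy from below.** If the row of the single linear test `g = f`
vanishes, `∫ ⟨F(u), f⟩ dμ = 0`, for a probability law with finite mean energy, then
`‖f‖₂² ≤ ν ‖Δf‖₂ (ensembleEnergy μ)^{1/2} + C · ensembleEnergy μ` for every bound
`Σᵢ ‖∂ᵢ f(x)‖ ≤ C`. (No level or band hypothesis is needed for this implication itself.) [folklore] -/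
theorem force_sq_le_of_momentumRow {ν : ℝ} (hν : 0 ≤ ν)
    {f : UnitAddTorus (Fin 3) → EuclideanSpace ℝ (Fin 3)} (hfs : Torus.IsSmooth f)
    {C : ℝ} (hC : ∀ x, ∑ i, ‖Torus.partialDeriv i f x‖ ≤ C)
    {μ : Measure (Torus.energySpace (Fin 3))} [IsProbabilityMeasure μ]
    (h2 : Integrable (fun u : Torus.energySpace (Fin 3) => ‖u‖ ^ 2) μ)
    (hrow : ∫ u, Torus.nsGeneratorPairing ν f u f ∂μ = 0) :
    ∫ x, ‖f x‖ ^ 2 ≤ ν * Real.sqrt (∫ x, ‖Torus.laplacian f x‖ ^ 2) * Real.sqrt (Torus.ensembleEnergy μ) +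
      C * Torus.ensembleEnergy μ := by
  have hΔ : MemLp (Torus.laplacian f) 2 volume := hfs.laplacian.memLp 2
  have hnorm : Integrable (fun u : Torus.energySpace (Fin 3) => ‖u‖) μ :=
    ((memLp_two_iff_integrable_sq continuous_norm.aestronglyMeasurable).2 h2).integrable one_le_two
  -- the three summands of the row, as functions of `u`
  have hff : ∀ u : Torus.energySpace (Fin 3),
      Torus.nsGeneratorPairing ν f u f = (∫ x, ‖f x‖ ^ 2) +
        ν * Torus.pairing (u.1 : L2T3) (Torus.laplacian f) + Torus.inertialPairing (u.1 : L2T3) f := by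
    intro u
    unfold Torus.nsGeneratorPairing Torus.pairing
    congr 2
    refine integral_congr_ae (ae_of_all _ fun x => ?_)
    exact real_inner_self_eq_norm_sq (f x)
  -- integrability and bounds of the two `u`-dependent summands
  have hpair_int : Integrable (fun u : Torus.energySpace (Fin 3) =>
      Torus.pairing (u.1 : L2T3) (Torus.laplacian f)) μ := by
    refine Integrable.mono' (hnorm.mul_const ‖hΔ.toLp (Torus.laplacian f)‖)
      (Torus.continuous_pairing_coe hΔ).aestronglyMeasurable (ae_of_all _ fun u => ?_)
    rw [Real.norm_eq_abs]
    exact Torus.abs_pairing_coe_le hΔ u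
  have hin_bound : ∀ u : Torus.energySpace (Fin 3), |Torus.inertialPairing (u.1 : L2T3) f| ≤ C * ‖u‖ ^ 2 := by
    intro u
    have h := (Torus.integrable_inner_fderiv_apply_coe hfs hC (u.1 : L2T3) (u.1 : L2T3)).2
    have hn : ‖(u.1 : L2T3)‖ = ‖u‖ := rfl
    rw [hn, ← sq] at h
    exact h
  have hin_int : Integrable (fun u : Torus.energySpace (Fin 3) => Torus.inertialPairing (u.1 : L2T3) f) μ := by
    refine Integrable.mono' (h2.const_mul C) (Torus.continuous_inertialPairing_coe hfs).aestronglyMeasurable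
      (ae_of_all _ fun u => ?_)
    rw [Real.norm_eq_abs]
    exact hin_bound u
  -- integrate the row
  have hi0 : Integrable (fun _ : Torus.energySpace (Fin 3) => ∫ x, ‖f x‖ ^ 2) μ := integrable_const _
  have hi1 : Integrable (fun u : Torus.energySpace (Fin 3) =>
      ν * Torus.pairing (u.1 : L2T3) (Torus.laplacian f)) μ := hpair_int.const_mul ν
  have hi01 : Integrable (fun u : Torus.energySpace (Fin 3) =>
      (∫ x, ‖f x‖ ^ 2) + ν * Torus.pairing (u.1 : L2T3) (Torus.laplacian f)) μ := hi0.add hi1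
  have hsplit : ∫ u, Torus.nsGeneratorPairing ν f u f ∂μ = (∫ x, ‖f x‖ ^ 2) +
      ν * ∫ u, Torus.pairing (u.1 : L2T3) (Torus.laplacian f) ∂μ +
        ∫ u, Torus.inertialPairing (u.1 : L2T3) f ∂μ := by
    simp_rw [hff]
    rw [integral_add hi01 hin_int, integral_add hi0 hi1, integral_const_mul, integral_const]
    simp
  rw [hrow] at hsplit
  -- bounds
  have hE0 : 0 ≤ Torus.ensembleEnergy μ := integral_nonneg fun u => by positivity
  have hCS : ∫ u : Torus.energySpace (Fin 3), ‖u‖ ∂μ ≤ Real.sqrt (Torus.ensembleEnergy μ) :=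
    Torus.integral_le_sqrt_integral_sq (ae_of_all _ fun u => norm_nonneg u)
      continuous_norm.aestronglyMeasurable h2
  have hb1 : |∫ u, Torus.pairing (u.1 : L2T3) (Torus.laplacian f) ∂μ| ≤
      Real.sqrt (∫ x, ‖Torus.laplacian f x‖ ^ 2) * Real.sqrt (Torus.ensembleEnergy μ) := by
    calc |∫ u, Torus.pairing (u.1 : L2T3) (Torus.laplacian f) ∂μ|
        ≤ ∫ u, |Torus.pairing (u.1 : L2T3) (Torus.laplacian f)| ∂μ := abs_integral_le_integral_abs
      _ ≤ ∫ u : Torus.energySpace (Fin 3), ‖u‖ * ‖hΔ.toLp (Torus.laplacian f)‖ ∂μ :=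
          integral_mono hpair_int.abs (hnorm.mul_const _) fun u => Torus.abs_pairing_coe_le hΔ u
      _ = ‖hΔ.toLp (Torus.laplacian f)‖ * ∫ u : Torus.energySpace (Fin 3), ‖u‖ ∂μ := by
          rw [integral_mul_const, mul_comm]
      _ ≤ ‖hΔ.toLp (Torus.laplacian f)‖ * Real.sqrt (Torus.ensembleEnergy μ) :=
          mul_le_mul_of_nonneg_left hCS (norm_nonneg _)
      _ = Real.sqrt (∫ x, ‖Torus.laplacian f x‖ ^ 2) * Real.sqrt (Torus.ensembleEnergy μ) := by
          rw [Torus.norm_toLp_eq_sqrt hΔ]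
  have hb2 : |∫ u, Torus.inertialPairing (u.1 : L2T3) f ∂μ| ≤ C * Torus.ensembleEnergy μ := by
    calc |∫ u, Torus.inertialPairing (u.1 : L2T3) f ∂μ|
        ≤ ∫ u, |Torus.inertialPairing (u.1 : L2T3) f| ∂μ := abs_integral_le_integral_abs
      _ ≤ ∫ u : Torus.energySpace (Fin 3), C * ‖u‖ ^ 2 ∂μ := integral_mono hin_int.abs (h2.const_mul C) hin_bound
      _ = C * Torus.ensembleEnergy μ := by rw [integral_const_mul]; rfl
  have e1 := mul_le_mul_of_nonneg_left (abs_le.1 hb1).1 hν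
  have e2 := (abs_le.1 hb2).1
  linarith [e1, e2, hsplit]

/-- The linear test `g = f` in the crux's format: for `m = 1`, `g₀ = f`, `P = X₀`, `∇p(u) = f`. [folklore] -/
theorem polyGrad_X (f : UnitAddTorus (Fin 3) → EuclideanSpace ℝ (Fin 3)) (u : Torus.energySpace (Fin 3)) :
    polyGrad (fun _ : Fin 1 => f) (MvPolynomial.X 0) u = f := by
  funext x
  simp [polyGrad, MvPolynomial.pderiv_X]

/-- **Energy floor for witnesses with a band-limited force**: if the witness force `f` is itself a
level-`N` band test (e.g. a trigonometric polynomial force at levels `N ≥ N_f`), every polynomially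
`d`-stationary (`d ≥ 2`) level-`N` law with finite mean energy obeys
`‖f‖₂² ≤ ν‖Δf‖₂ √(ensembleEnergy μ) + C_f · ensembleEnergy μ`. In `QuarticGate` (`energy ≤ E`,
`ν = ν_j → 0`): `E ≥ (‖f‖₂² − ν_j‖Δf‖₂√E)/C_f`, and with (C), `ε ≤ ‖f‖₂√E ≤ ((ν_j‖Δf‖₂√E + C_f E) E)^{1/2}`.
[folklore] -/
theorem force_sq_le_of_polyStationary {ν : ℝ} (hν : 0 ≤ ν)
    {f : UnitAddTorus (Fin 3) → EuclideanSpace ℝ (Fin 3)} {N : ℕ} (hfb : IsBandTest N f)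
    {C : ℝ} (hC : ∀ x, ∑ i, ‖Torus.partialDeriv i f x‖ ≤ C)
    {μ : Measure (Torus.energySpace (Fin 3))} [IsProbabilityMeasure μ]
    (h2 : Integrable (fun u : Torus.energySpace (Fin 3) => ‖u‖ ^ 2) μ) {d : ℕ} (hd : 2 ≤ d)
    (hstat : IsPolyStationary ν f N d μ) :
    ∫ x, ‖f x‖ ^ 2 ≤ ν * Real.sqrt (∫ x, ‖Torus.laplacian f x‖ ^ 2) * Real.sqrt (Torus.ensembleEnergy μ) +
      C * Torus.ensembleEnergy μ := by
  obtain ⟨-, hzero⟩ := hstat 1 (fun _ => f) (MvPolynomial.X 0) (fun _ => hfb)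
    (by rw [MvPolynomial.totalDegree_X]; omega)
  simp only [polyGrad_X] at hzero
  exact force_sq_le_of_momentumRow hν hfb.1 hC h2 hzero

/-- Packaged for witnesses: `ε`-independent energy floor `‖f‖₂² ≤ ν‖Δf‖₂√E + C_f E` for every
`QuarticGate` witness whose (smooth, solenoidal, mean-zero) force is band-limited at the level. [folklore] -/
theorem IsQuarticWitness.force_sq_le {f : UnitAddTorus (Fin 3) → EuclideanSpace ℝ (Fin 3)} {ν : ℝ}
    (hν : 0 ≤ ν) {N : ℕ} (hfb : IsBandTest N f) {C : ℝ} (hC : ∀ x, ∑ i, ‖Torus.partialDeriv i f x‖ ≤ C)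
    {E ε : ℝ} {μ : Measure (Torus.energySpace (Fin 3))} (h : IsQuarticWitness f ν N E ε μ) :
    ∫ x, ‖f x‖ ^ 2 ≤ ν * Real.sqrt (∫ x, ‖Torus.laplacian f x‖ ^ 2) * Real.sqrt E + C * E := by
  obtain ⟨hprob, -, h4, hstat, hEn, -⟩ := h
  have h2 := integrable_norm_sq_of_norm_pow_four h4
  have hC0 : 0 ≤ C := le_trans (Finset.sum_nonneg fun i _ => norm_nonneg _) (hC 0)
  have hE0 : 0 ≤ Torus.ensembleEnergy μ := integral_nonneg fun u => by positivity
  have key := force_sq_le_of_polyStationary hν hfb hC h2 (by norm_num : 2 ≤ 4) hstat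
  calc ∫ x, ‖f x‖ ^ 2 ≤ _ := key
    _ ≤ ν * Real.sqrt (∫ x, ‖Torus.laplacian f x‖ ^ 2) * Real.sqrt E + C * E := by
        gcongr

end MomentumRow

end

end Summit.AnomalousDissipation.AnomalousDissipation.Theorems.QuarticGate.Negative
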